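/-
Copyright (c) 2026. All rights reserved.
Released under Apache 2.0 license as described in the file LICENSE.
Authors: abc-iut cell, cone prover abc-iut-w6-d034 (block C, wave W6).
-/
import Literature.AnabelianGeometry.AbsoluteAnabelian.MonoAnalyticArchModelProofs
import Mathlib.Analysis.SpecialFunctions.Complex.Arg
import Mathlib.Order.Interval.Set.Basic
import HarnessLib

/-!
# [AbsTopIII] Proposition 5.8 (v): the core segment `ℐ_{C~}` is UNIQUE and maps ONTO `C^×` — PROOF companion

S. Mochizuki, *Topics in absolute anabelian geometry III: global reconstruction algorithms*,
J. Math. Sci. Univ. Tokyo 22 (2015) 939–1156 [MochizukiAbsTopIII2015], Prop 5.8 (v), manuscript p. 140 l. 33–47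
(DAG node **AbsTopIII:Prop5.8(v)** of the abc-iut cell).

Proof-only companion (no `def`, no named fact, no hypothesis) to the LANDED statement files `LogShells.lean` (p403899:
`ComplexLogShell.coreSegment := Icc (-π) π`, `ComplexLogShell.logShell`) and `MonoAnalyticLogShells.lean` (p404450:
`MonoAnalyticArch.coreSeg`, `.exists_endpoint`, `.logShell`) and to the discharge file `MonoAnalyticArchModelProofs.lean`
(p411667: the archimedean algorithm EXISTS; `exp_mul_I_injOn`, `exp_pi_mul_I_eq_exp_neg_pi_mul_I`).

Print, Prop 5.8 (v): "… where we write `ℐ_{C~} ⊆ C~` for the **unique** compact line segment on `C~` that is invariant with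
respect to the action of `±1` and, moreover, maps **bijectively**, except for its endpoints, to `C^×`". In the model
`C~ = ℝ → C^× = S¹ ⊆ ℂ`, `θ ↦ e^{iθ}` (the covering of p411667's construction) the tree so far records, for the typer's
`coreSegment = [-π, π]`, injectivity on the interior and the identification of the endpoints. PROVED here:

* `ComplexLogShell.image_exp_mul_I_coreSegment` — `[-π, π]` maps ONTO `C^× = S¹` (`e^{i·}'' [-π, π] = sphere 0 1`);
  `ComplexLogShell.bijOn_exp_mul_I_Ioc` — "bijectively, except for its endpoints": `θ ↦ e^{iθ}` is a bijection
  `(-π, π] → S¹`;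
* `ComplexLogShell.Icc_eq_coreSegment_of_surjOn` — UNIQUENESS: a compact segment `[b, c]` (`b ≤ c`) of `C~ = ℝ` that is
  invariant under `±1`, on whose interior `θ ↦ e^{iθ}` is injective, and which maps onto `S¹`, IS `[-π, π]`;
  `ComplexLogShell.Icc_eq_coreSegment_iff` — the characterisation as an `iff`;
* in the typer's shape (`MonoAnalyticArch.exists_endpoint` records `ℐ_{C~}` as `[-1, 1]·x₀` with injectivity on
  `(-1, 1)·x₀` and `x₀`, `-x₀` identified): `ComplexLogShell.endpoint_eq_pi_or_eq_neg_pi` — if moreover `[-1, 1]·x₀` maps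
  onto `C^×` then `x₀ = ±π`; `ComplexLogShell.endpoint_iff` — the three clauses hold iff `x₀ = ±π`
  (auxiliary: `setOf_Icc_smul_eq`, `setOf_Ioo_smul_eq`: `[-1, 1]·x₀ = [-|x₀|, |x₀|]`, `(-1, 1)·x₀ = (-|x₀|, |x₀|)`).

Classical complex analysis only (`Complex.arg`); nothing anabelian is assumed. Refereed pre-IUT anabelian geometry; nothing
here bears on [IUTchIII] Cor. 3.12; typed ≠ discharged elsewhere.
-/

set_option autoImplicit false

open Complex Set Metric

namespace Literature.AnabelianGeometry.AbsoluteAnabelian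

namespace ComplexLogShell

/-- **Prop 5.8 (v)**, "maps … to `C^×`" is ONTO: the core segment `ℐ_{C~} = [-π, π]` of `C~ = ℝ` maps onto the unit
circle `C^× = S¹` under the covering `θ ↦ e^{iθ}` (every `z` with `‖z‖ = 1` is `e^{i·arg z}`, `arg z ∈ (-π, π]`).
[cite: MochizukiAbsTopIII2015, Prop 5.8 (v) p. 140] -/
theorem image_exp_mul_I_coreSegment :
    (fun θ : ℝ => Complex.exp (θ * I)) '' coreSegment = sphere (0 : ℂ) 1 := by
  ext z
  simp only [mem_image, coreSegment, mem_Icc, mem_sphere, dist_zero_right]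
  constructor
  · rintro ⟨θ, -, rfl⟩
    exact Complex.norm_exp_ofReal_mul_I θ
  · intro hz
    refine ⟨arg z, ⟨(neg_pi_lt_arg z).le, arg_le_pi z⟩, ?_⟩
    have h := norm_mul_exp_arg_mul_I z
    rw [hz] at h
    simpa using h

/-- **Prop 5.8 (v)**, "maps bijectively, except for its endpoints, to `C^×`": dropping one endpoint, `θ ↦ e^{iθ}` is a
bijection from `(-π, π]` onto `C^× = S¹` (`arg` is the inverse). [cite: MochizukiAbsTopIII2015, Prop 5.8 (v) p. 140] -/
theorem bijOn_exp_mul_I_Ioc :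
    BijOn (fun θ : ℝ => Complex.exp (θ * I)) (Ioc (-Real.pi) Real.pi) (sphere (0 : ℂ) 1) := by
  have harg : ∀ θ : ℝ, θ ∈ Ioc (-Real.pi) Real.pi → arg (Complex.exp (θ * I)) = θ := by
    intro θ hθ
    rw [Complex.arg_exp_mul_I, toIocMod_eq_self Real.two_pi_pos]
    exact ⟨hθ.1, by linarith [hθ.2]⟩
  refine ⟨?_, ?_, ?_⟩
  · intro θ _
    rw [mem_sphere, dist_zero_right]
    exact Complex.norm_exp_ofReal_mul_I θ
  · intro a ha b hb hab
    have := congrArg arg hab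
    simp only at this
    rwa [harg a ha, harg b hb] at this
  · intro z hz
    rw [mem_sphere, dist_zero_right] at hz
    refine ⟨arg z, ⟨neg_pi_lt_arg z, arg_le_pi z⟩, ?_⟩
    have h := norm_mul_exp_arg_mul_I z
    rw [hz] at h
    simpa using h

/-- a preimage of `-1 ∈ C^×` under `θ ↦ e^{iθ}` is an odd multiple of `π`, hence has `|θ| ≥ π`.
[cite: MochizukiAbsTopIII2015, Prop 5.8 (v) p. 140] -/
theorem pi_le_abs_of_exp_mul_I_eq_neg_one {θ : ℝ} (h : Complex.exp (θ * I) = -1) : Real.pi ≤ |θ| := by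
  have h' : Complex.exp (θ * I) = Complex.exp (Real.pi * I) := by rw [h, Complex.exp_pi_mul_I]
  obtain ⟨n, hn⟩ := Complex.exp_eq_exp_iff_exists_int.1 h'
  have hθ : θ = Real.pi + n * (2 * Real.pi) := by
    have := congrArg Complex.im hn
    simpa using this
  rcases le_or_gt 0 n with hn0 | hn0
  · have hn' : (0 : ℝ) ≤ n := by exact_mod_cast hn0
    have : Real.pi ≤ θ := by nlinarith [Real.pi_pos]
    exact this.trans (le_abs_self θ)
  · have hn1 : n ≤ -1 := by omega
    have hn' : (n : ℝ) ≤ -1 := by exact_mod_cast hn1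
    have : θ ≤ -Real.pi := by nlinarith [Real.pi_pos]
    have : Real.pi ≤ -θ := by linarith
    exact this.trans (neg_le_abs θ)

/-- **Prop 5.8 (v), UNIQUENESS of `ℐ_{C~}`**: a compact line segment `[b, c]` of `C~ = ℝ` which is invariant under `±1`,
on whose interior the covering `θ ↦ e^{iθ}` of `C^×` is injective, and which maps onto `C^× = S¹`, is the core segment
`[-π, π]`. (Invariance forces `b = -c`; surjectivity forces `π ≤ c` since `-1 = e^{iθ}` needs `|θ| ≥ π`; injectivity
on `(-c, c)` forces `c ≤ π` since `e^{iπ} = e^{-iπ}`.) [cite: MochizukiAbsTopIII2015, Prop 5.8 (v) p. 140] -/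
theorem Icc_eq_coreSegment_of_surjOn {b c : ℝ} (hbc : b ≤ c)
    (hsymm : ∀ x ∈ Icc b c, -x ∈ Icc b c)
    (hinj : InjOn (fun θ : ℝ => Complex.exp (θ * I)) (Ioo b c))
    (hsurj : sphere (0 : ℂ) 1 ⊆ (fun θ : ℝ => Complex.exp (θ * I)) '' Icc b c) :
    Icc b c = coreSegment := by
  -- invariance under `±1` forces `b = -c`
  have hb : b = -c := by
    have h1 := (hsymm b ⟨le_rfl, hbc⟩).2
    have h2 := (hsymm c ⟨hbc, le_rfl⟩).1
    linarith
  subst hb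
  -- onto `S¹` forces `π ≤ c`
  have hπc : Real.pi ≤ c := by
    have hm : (-1 : ℂ) ∈ sphere (0 : ℂ) 1 := by simp
    obtain ⟨θ, hθ, hθe⟩ := hsurj hm
    have habs := pi_le_abs_of_exp_mul_I_eq_neg_one hθe
    have : |θ| ≤ c := abs_le.2 ⟨hθ.1, hθ.2⟩
    linarith
  -- injective on the interior forces `c ≤ π`
  have hcπ : c ≤ Real.pi := by
    refine le_of_not_gt fun hlt => ?_
    have h1 : Real.pi ∈ Ioo (-c) c := ⟨by linarith [Real.pi_pos], hlt⟩
    have h2 : -Real.pi ∈ Ioo (-c) c := ⟨by linarith, by linarith [Real.pi_pos]⟩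
    have : Real.pi = -Real.pi := hinj h1 h2 exp_pi_mul_I_eq_exp_neg_pi_mul_I
    linarith [Real.pi_pos]
  obtain rfl : c = Real.pi := le_antisymm hcπ hπc
  rfl

/-- **Prop 5.8 (v)**: CHARACTERISATION of the core segment among the compact line segments `[b, c]` (`b ≤ c`) of
`C~ = ℝ`: invariant under `±1` ∧ `θ ↦ e^{iθ}` injective on the interior ∧ image `= C^× = S¹` **iff** `[b, c] = ℐ_{C~}`
(`= [-π, π]`, the typer's `ComplexLogShell.coreSegment`). [cite: MochizukiAbsTopIII2015, Prop 5.8 (v) p. 140] -/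
theorem Icc_eq_coreSegment_iff {b c : ℝ} (hbc : b ≤ c) :
    ((∀ x ∈ Icc b c, -x ∈ Icc b c) ∧ InjOn (fun θ : ℝ => Complex.exp (θ * I)) (Ioo b c) ∧
        (fun θ : ℝ => Complex.exp (θ * I)) '' Icc b c = sphere (0 : ℂ) 1) ↔
      Icc b c = coreSegment := by
  constructor
  · rintro ⟨hsymm, hinj, himage⟩
    exact Icc_eq_coreSegment_of_surjOn hbc hsymm hinj himage.symm.subset
  · intro h
    obtain ⟨rfl, rfl⟩ := (Icc_eq_Icc_iff hbc).1 h
    refine ⟨?_, exp_mul_I_injOn, image_exp_mul_I_coreSegment⟩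
    rintro x ⟨hx1, hx2⟩
    exact ⟨by linarith, by linarith⟩

/-! ## The same uniqueness in the shape of `MonoAnalyticArch.exists_endpoint` (segments `[-1, 1]·x₀`) -/

/-- the segment `[-1, 1]·x₀` of `C~ = ℝ` (the shape in which `MonoAnalyticArch.exists_endpoint` records `ℐ_{C~}`) is
`[-|x₀|, |x₀|]`. [cite: MochizukiAbsTopIII2015, Prop 5.8 (v) p. 140] -/
theorem setOf_Icc_smul_eq (x₀ : ℝ) :
    {x : ℝ | ∃ t : ℝ, t ∈ Icc (-1 : ℝ) 1 ∧ x = t • x₀} = Icc (-|x₀|) |x₀| := by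
  ext x
  simp only [mem_setOf_eq, mem_Icc, smul_eq_mul]
  constructor
  · rintro ⟨t, ⟨ht1, ht2⟩, rfl⟩
    have h : |t * x₀| ≤ |x₀| := by
      rw [abs_mul]
      exact mul_le_of_le_one_left (abs_nonneg _) (_root_.abs_le.2 ⟨ht1, ht2⟩)
    exact ⟨by linarith [neg_abs_le (t * x₀)], (le_abs_self _).trans h⟩
  · rintro ⟨h1, h2⟩
    by_cases hx₀ : x₀ = 0
    · refine ⟨0, ⟨by norm_num, by norm_num⟩, ?_⟩
      subst hx₀
      simp only [abs_zero, neg_zero] at h1 h2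
      linarith
    · refine ⟨x / x₀, ?_, (div_mul_cancel₀ x hx₀).symm⟩
      have h : |x / x₀| ≤ 1 := by
        rw [abs_div, div_le_one (abs_pos.2 hx₀)]
        exact _root_.abs_le.2 ⟨h1, h2⟩
      exact _root_.abs_le.1 h

/-- the open segment `(-1, 1)·x₀` of `C~ = ℝ` (`x₀ ≠ 0`) is `(-|x₀|, |x₀|)`.
[cite: MochizukiAbsTopIII2015, Prop 5.8 (v) p. 140] -/
theorem setOf_Ioo_smul_eq {x₀ : ℝ} (hx₀ : x₀ ≠ 0) :
    {x : ℝ | ∃ t : ℝ, t ∈ Ioo (-1 : ℝ) 1 ∧ x = t • x₀} = Ioo (-|x₀|) |x₀| := by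
  ext x
  simp only [mem_setOf_eq, mem_Ioo, smul_eq_mul]
  constructor
  · rintro ⟨t, ⟨ht1, ht2⟩, rfl⟩
    have h : |t * x₀| < |x₀| := by
      rw [abs_mul]
      exact mul_lt_of_lt_one_left (abs_pos.2 hx₀) (_root_.abs_lt.2 ⟨ht1, ht2⟩)
    exact ⟨by linarith [neg_abs_le (t * x₀)], (le_abs_self _).trans_lt h⟩
  · rintro ⟨h1, h2⟩
    refine ⟨x / x₀, ?_, (div_mul_cancel₀ x hx₀).symm⟩
    have h : |x / x₀| < 1 := by
      rw [abs_div, div_lt_one (abs_pos.2 hx₀)]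
      exact _root_.abs_lt.2 ⟨h1, h2⟩
    exact _root_.abs_lt.1 h

/-- **Prop 5.8 (v), UNIQUENESS in the typer's shape**: at the model `C~ = ℝ → C^×`, `θ ↦ e^{iθ}` (p411667), if a
segment `[-1, 1]·x₀` (automatically invariant under `±1`) maps ONTO `C^×` with the covering injective on `(-1, 1)·x₀`
(the clauses of `MonoAnalyticArch.exists_endpoint` plus surjectivity), then `x₀ = ±π`: the segment is `ℐ_{C~} = [-π, π]`.
[cite: MochizukiAbsTopIII2015, Prop 5.8 (v) p. 140] -/
theorem endpoint_eq_pi_or_eq_neg_pi {x₀ : ℝ}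
    (hinj : InjOn (fun θ : ℝ => Complex.exp (θ * I)) {x : ℝ | ∃ t : ℝ, t ∈ Ioo (-1 : ℝ) 1 ∧ x = t • x₀})
    (hsurj : sphere (0 : ℂ) 1 ⊆
      (fun θ : ℝ => Complex.exp (θ * I)) '' {x : ℝ | ∃ t : ℝ, t ∈ Icc (-1 : ℝ) 1 ∧ x = t • x₀}) :
    x₀ = Real.pi ∨ x₀ = -Real.pi := by
  have hx₀ : x₀ ≠ 0 := by
    rintro rfl
    have hm : (-1 : ℂ) ∈ sphere (0 : ℂ) 1 := by simp
    obtain ⟨θ, ⟨t, -, ht⟩, hθe⟩ := hsurj hm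
    rw [smul_zero] at ht
    subst ht
    have h : Complex.exp (((0 : ℝ) : ℂ) * I) = -1 := hθe
    norm_num at h
  rw [setOf_Icc_smul_eq] at hsurj
  rw [setOf_Ioo_smul_eq hx₀] at hinj
  have h0 : -|x₀| ≤ |x₀| := by linarith [abs_nonneg x₀]
  have h := Icc_eq_coreSegment_of_surjOn h0
    (fun x hx => ⟨by linarith [hx.2], by linarith [hx.1]⟩) hinj hsurj
  have h' : |x₀| = Real.pi := ((Icc_eq_Icc_iff h0).1 h).2
  exact (abs_eq Real.pi_pos.le).1 h'

/-- **Prop 5.8 (v)** in the typer's shape, as an `iff`: for a segment `[-1, 1]·x₀` of the model `C~ = ℝ`, (the covering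
`θ ↦ e^{iθ}` is injective on `(-1, 1)·x₀`) ∧ (the endpoints `±x₀` have the same image) ∧ (the segment maps onto
`C^× = S¹`) **iff** `x₀ = ±π` — "the unique compact line segment … invariant [under] `±1` [that] maps bijectively, except
for its endpoints, to `C^×`". [cite: MochizukiAbsTopIII2015, Prop 5.8 (v) p. 140] -/
theorem endpoint_iff (x₀ : ℝ) :
    (InjOn (fun θ : ℝ => Complex.exp (θ * I)) {x : ℝ | ∃ t : ℝ, t ∈ Ioo (-1 : ℝ) 1 ∧ x = t • x₀} ∧
        Complex.exp ((x₀ : ℂ) * I) = Complex.exp (((-x₀ : ℝ) : ℂ) * I) ∧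
        sphere (0 : ℂ) 1 ⊆
          (fun θ : ℝ => Complex.exp (θ * I)) '' {x : ℝ | ∃ t : ℝ, t ∈ Icc (-1 : ℝ) 1 ∧ x = t • x₀}) ↔
      (x₀ = Real.pi ∨ x₀ = -Real.pi) := by
  constructor
  · rintro ⟨hinj, -, hsurj⟩
    exact endpoint_eq_pi_or_eq_neg_pi hinj hsurj
  · intro h
    have hx₀ : x₀ ≠ 0 := by rcases h with rfl | rfl <;> linarith [Real.pi_pos]
    have habs : |x₀| = Real.pi := by
      rcases h with rfl | rfl
      · exact abs_of_pos Real.pi_pos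
      · rw [abs_neg]; exact abs_of_pos Real.pi_pos
    rw [setOf_Ioo_smul_eq hx₀, setOf_Icc_smul_eq, habs]
    refine ⟨exp_mul_I_injOn, ?_, image_exp_mul_I_coreSegment.symm.subset⟩
    rcases h with rfl | rfl
    · exact exp_pi_mul_I_eq_exp_neg_pi_mul_I
    · rw [neg_neg]; exact exp_pi_mul_I_eq_exp_neg_pi_mul_I.symm

end ComplexLogShell

end Literature.AnabelianGeometry.AbsoluteAnabelian
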